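import Mathlib
import Summits.Ventures.PercRepro2.Defs
import Summits.Ventures.PercRepro2.Harris
import Summits.Ventures.PercRepro2.Graph
import Summits.Ventures.PercRepro2.Events
import Summits.Ventures.PercRepro2.Induced
import Summits.Ventures.PercRepro2.SideCluster
import Summits.Ventures.PercRepro2.HullTree
import Summits.Ventures.PercRepro2.ForestCluster
import Summits.Ventures.PercRepro2.XorHalf
import Summits.Ventures.PercRepro2.CRForms
import Summits.Ventures.PercRepro2.CRFKG
import Summits.Ventures.PercRepro2.CRClusterLaw

/-!
# (CR) and (XOR) on every forest (blind cell PercRepro2, mine-a g39; MINE-A.md §94.0, §94.9–§94.10;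
proofs/MINEA-CRFKG.md §3)

Two theorems of the cell compose: mine-c g8's `ForestCluster.clusterLogSupermod_of_isForest` (on a
forest the root-cluster law `S ↦ P(C_s = S)` satisfies the FKG lattice condition
`ClusterLogSupermod`, SideCluster.lean) and mine-a g39's `CRClusterLaw.cr_of_clusterLaw_lsm`
((CR) holds whenever the cluster law satisfies that condition).  Hence

* `cr_of_clusterLogSupermod`: `ClusterLogSupermod p ends s` ⟹ (CR), the hypothesis `hcr` of
  `CRForms.xorForm_nonneg_of_cr`;
* `cr_of_isForest`: **(CR) on every forest** — for admissible weights, a forest `ends`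
  (`Hull.IsForest`: injective `ends`, acyclic graph of all edges), a root `s`, a finite `X` and
  up-sets `𝓤, 𝓥`: `0 ≤ P(R)·P(Rᶜ ∩ U ∩ e) + P(R ∩ U)·P(R ∩ e) − P(R)·P(U)·P(e)`, i.e.
  `Cov(U, e) ≥ P(R) · Cov(U, e ∣ R)` with `R = {s ↮ X}`, `U = {C_s ∈ 𝓤}`, `e = {C_s ∈ 𝓥}`;
* `xorForm_nonneg_of_isForest`: the (XOR) polarisation of MINE-A.md §93.7 on every forest, for every
  `P(R)` (XorHalf.lean has it for `P(R) ≤ 1/2` on every graph).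

On a general graph the cluster law is not log-supermodular (MINE-A.md §94.1) and (CR) stays the
open candidate.  No definition; one seat.
-/

namespace Summit.Ventures.PercRepro2

namespace CRForest

open scoped Classical

variable {V : Type*} {E : Type*} [Fintype V] [Fintype E]
  {K : Type*} [Field K] [LinearOrder K] [IsStrictOrderedRing K]

/-- **(CR) under `ClusterLogSupermod`** (the cell's hypothesis of SideCluster.lean). -/
theorem cr_of_clusterLogSupermod (p : E → K) (hp : IsProbVec p) (ends : E → Sym2 V) (s : V)
    (hlsm : ClusterLogSupermod p ends s) (X : Finset V) {𝓤 𝓥 : Set (Set V)}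
    (h𝓤 : IsUpperSet 𝓤) (h𝓥 : IsUpperSet 𝓥) :
    let Rv := avoidAll ends s X
    let U := clusterInEvent ends s 𝓤
    let e := clusterInEvent ends s 𝓥
    0 ≤ prob p Rv * prob p (Rvᶜ ∩ U ∩ e) + prob p (Rv ∩ U) * prob p (Rv ∩ e) -
        prob p Rv * prob p U * prob p e :=
  CRClusterLaw.cr_of_clusterLaw_lsm ends s p hp X h𝓤 h𝓥 (fun S T => hlsm S T)

/-- **(CR) on every forest.** -/
theorem cr_of_isForest (p : E → K) (hp : IsProbVec p) {ends : E → Sym2 V}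
    (hF : Hull.IsForest ends) (s : V) (X : Finset V) {𝓤 𝓥 : Set (Set V)}
    (h𝓤 : IsUpperSet 𝓤) (h𝓥 : IsUpperSet 𝓥) :
    let Rv := avoidAll ends s X
    let U := clusterInEvent ends s 𝓤
    let e := clusterInEvent ends s 𝓥
    0 ≤ prob p Rv * prob p (Rvᶜ ∩ U ∩ e) + prob p (Rv ∩ U) * prob p (Rv ∩ e) -
        prob p Rv * prob p U * prob p e :=
  cr_of_clusterLogSupermod p hp ends s (ForestCluster.clusterLogSupermod_of_isForest p hp hF s)
    X h𝓤 h𝓥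

/-- **(XOR) on every forest**, for every value of `P(R)`. -/
theorem xorForm_nonneg_of_isForest (p : E → K) (hp : IsProbVec p) {ends : E → Sym2 V}
    (hF : Hull.IsForest ends) (s : V) (X : Finset V) {𝓤 𝓥 : Set (Set V)}
    (h𝓤 : IsUpperSet 𝓤) (h𝓥 : IsUpperSet 𝓥) :
    let Rv := avoidAll ends s X
    let U := clusterInEvent ends s 𝓤
    let e := clusterInEvent ends s 𝓥
    0 ≤ prob p (Rv ∩ U ∩ e) * prob p Rvᶜ + prob p (Rvᶜ ∩ U ∩ e) * prob p Rv -
        prob p (Rv ∩ U) * prob p (Rvᶜ ∩ e) - prob p (Rvᶜ ∩ U) * prob p (Rv ∩ e) :=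
  CRForms.xorForm_nonneg_of_cr p hp ends s X h𝓤 h𝓥 (cr_of_isForest p hp hF s X h𝓤 h𝓥)

end CRForest

end Summit.Ventures.PercRepro2
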